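import Mathlib.AlgebraicGeometry.ZariskisMainTheorem
import Mathlib.AlgebraicGeometry.Geometrically.Irreducible
import Literature.AlgebraicGeometry.HodgeTheory.GlobalInvariantCycles
import Literature.AlgebraicGeometry.Motives.VarietiesProperProofs
import Literature.AlgebraicGeometry.AbelianSchemes.AbelianSchemeOverGeometricallyIntegral
import HarnessLib

/-!
# The total space of an abelian scheme over a smooth projective variety is a smooth projective variety (E6-Π)

Topic `Literature/AlgebraicGeometry/AbelianSchemes`, namespaces `Literature.AlgebraicGeometry.HodgeTheory` (§1, generic:
«quasi-projective and proper over `k` ⇒ projective over `k`») and `Literature.AlgebraicGeometry.AbelianSchemes.AbelianSchemeOver`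
(§2–§3).  THEOREMS ONLY (no definition, no named fact, no instance, no notation, no `sorry`).  Cell hodgecm-mathlib (D-0151),
P6 door (E), organ **E6-Π** (E6 owner A-p06 (g32) deal 2026-09-01T22:26:19Z, LEAD F0P6-plan (g2) «=» 22:26:59Z): the
`IsSmoothProjective` binder that ★ GAGA-for-maps `Transcendental.Arapura2012_Cor_15_4_6` asks of the TOTAL SPACE `P.A_ℂ → X_ℂ`
of the pulled-back universal abelian scheme over a projective record-curve piece.  HC_CM is proved only modulo the printed
citations until rung 0 closes; this file is generic and changes no count.

MATHEMATICS ([Hartshorne1977] II §4 p. 103, Cor. 4.8; [GortzWedhorn2020] Prop. 3.24 ∕ Cor. 16.52; [MumfordFogartyKirwan1994]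
Ch. 6 §1 Def. 6.1).  Let `S` be a `k`-scheme and `A → S` an abelian scheme of relative dimension `g` ([MFK] Def. 6.1: smooth,
proper, geometrically connected fibres), with total space `T := (A → S → Spec k)` (`Over.mk (A.X.hom ≫ S.hom)`; this is ★
`ComplexAnalytic.totalOver S A` by `rfl`).
* §1 `isProjectiveOver_of_isProper_of_isQuasiProjectiveOver` — a `k`-scheme which is QUASI-PROJECTIVE (an open `k`-immersion
  `j : X ↪ P` into a projective `P ↪ ℙᴺ_k`, ★ `IsQuasiProjectiveOver`) and PROPER over `k` is projective over `k`: `j` is proper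
  ([Hartshorne1977] II Cor. 4.8 (e): `X` proper, `P` separated), a proper monomorphism is a closed immersion (Mathlib
  `IsClosedImmersion.iff_isProper_and_mono`, Stacks 04XV), and closed immersions compose.
* §2 `isProper_total` (`A → S → k` proper when `S` is), `smoothOfRelativeDimension_total` (smooth of relative dimension `d + g`
  when `S` is smooth of relative dimension `d`: Mathlib `smoothOfRelativeDimension_comp`), `geometricallyIrreducible_total`
  (geometrically irreducible when `S` is: ★ `geometricallyIrreducible_hom_overBase` — every abelian scheme is geometrically
  irreducible over its base, [GortzWedhorn2020] Cor. 16.52 — and Mathlib `GeometricallyIrreducible.comp`, both maps being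
  universally open: `A → S` is smooth hence flat of finite presentation, `S → Spec k` maps to a field), `isQuasiProjectiveOver_total`
  bookkeeping (`IsQuasiProjectiveOver` of the total space is what the consumer supplies: for the pulled-back universal family it is
  ★ (F-c″) + ★ `isQuasiProjectiveOver_familyPullback_of_isSeparated`).
* §3 HEAD **`isSmoothProjective_total`** — if `S` is a smooth projective geometrically irreducible `k`-variety of dimension `d`
  (★ `IsSmoothProjective d S`), `A` has relative dimension `g` and the total space is quasi-projective over `k`, then the total
  space is a smooth projective geometrically irreducible `k`-variety of dimension `d + g` (★ `IsSmoothProjective (d + g) T`).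

## References
* [Hartshorne1977] R. Hartshorne, *Algebraic Geometry*, GTM 52 (1977), II §4 p. 103 (projective ∕ quasi-projective), Cor. 4.8
  (p. 102), Thm. 4.9 (p. 103).
* [StacksProject] The Stacks Project, Tag 04XV (proper monomorphism = closed immersion), Tag 038F, Tag 01UA.
* [GortzWedhorn2020] U. Görtz, T. Wedhorn, *Algebraic Geometry I*, 2nd ed. (2020), Cor. 16.52 ∕ Remark 16.54 (p. 539).
* [MumfordFogartyKirwan1994] D. Mumford, J. Fogarty, F. Kirwan, *Geometric Invariant Theory*, 3rd ed. (1994), Ch. 6 §1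
  Definition 6.1 (p. 115).
-/

set_option autoImplicit false

open CategoryTheory CategoryTheory.Limits AlgebraicGeometry MonoidalCategory

universe u

noncomputable section

/-! ### §1 Quasi-projective and proper over a field is projective -/

namespace Literature.AlgebraicGeometry.HodgeTheory

variable {k : Type u} [Field k] {X : Motives.SchemeOver k}

/-- **A quasi-projective `k`-scheme which is proper over `k` is projective over `k`** ([Hartshorne1977] II Cor. 4.8 (e) with
Stacks 04XV): the open immersion `j : X ↪ P` into a projective `P` is proper (`X → Spec k` proper, `P → Spec k` separated),
hence a closed immersion (proper monomorphism), and `X ↪ P ↪ ℙᴺ_k` is a closed `k`-immersion.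
[cite: Hartshorne1977, II Cor. 4.8 (e) (p. 102) and §4 Definition (p. 103)] [cite: StacksProject, Tag 04XV] -/
theorem isProjectiveOver_of_isProper_of_isQuasiProjectiveOver [IsProper X.hom] (h : IsQuasiProjectiveOver X) :
    Motives.IsProjectiveOver X := by
  obtain ⟨P, j, hP, hj⟩ := h
  obtain ⟨N, κ, hκ⟩ := hP
  haveI := hj
  haveI := hκ
  haveI : IsProper P.hom := Motives.IsProjectiveOver.isProper ⟨N, κ, hκ⟩
  -- `j` is proper: `j ≫ (P → Spec k) = (X → Spec k)` is proper and `P → Spec k` is separated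
  haveI : IsProper (j.left ≫ P.hom) := by rw [Over.w j]; infer_instance
  haveI : IsProper j.left := IsProper.of_comp j.left P.hom
  -- a proper monomorphism (open immersions are monomorphisms) is a closed immersion
  haveI : IsClosedImmersion j.left := (IsClosedImmersion.iff_isProper_and_mono j.left).mpr ⟨inferInstance, inferInstance⟩
  refine ⟨N, j ≫ κ, ?_⟩
  rw [Over.comp_left]
  infer_instance

end Literature.AlgebraicGeometry.HodgeTheory

/-! ### §2 The total space of an abelian scheme: proper, smooth, geometrically irreducible -/

namespace Literature.AlgebraicGeometry.AbelianSchemes.AbelianSchemeOver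

open Literature.AlgebraicGeometry.Motives (SchemeOver IsProjectiveOver IsSmoothProjective)
open Literature.AlgebraicGeometry.HodgeTheory (IsQuasiProjectiveOver)

variable {k : Type u} [Field k] {S : SchemeOver k} (A : AbelianSchemeOver S.left)

/-- The total space `A → S → Spec k` of an abelian scheme over a `k`-scheme PROPER over `k` is proper over `k`
(`A → S` is proper, [MumfordFogartyKirwan1994] Def. 6.1; proper morphisms compose, [Hartshorne1977] II Cor. 4.8 (b)).
[cite: Hartshorne1977, II Cor. 4.8 (b) (p. 102)] [cite: MumfordFogartyKirwan1994, Ch. 6 §1 Definition 6.1 (p. 115)] -/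
theorem isProper_total [IsProper S.hom] : IsProper (Over.mk (A.X.hom ≫ S.hom) : SchemeOver k).hom := by
  haveI := A.isProper
  change IsProper (A.X.hom ≫ S.hom)
  infer_instance

/-- The total space of an abelian scheme of relative dimension `g` over a `k`-scheme SMOOTH of relative dimension `d` is smooth
over `k` of relative dimension `d + g` (Mathlib `smoothOfRelativeDimension_comp`). [cite: Hartshorne1977, III Prop. 10.1 (c) (p. 270)] -/
theorem smoothOfRelativeDimension_total {d g : ℕ} [SmoothOfRelativeDimension d S.hom] (hA : A.IsOfRelDim g) :
    SmoothOfRelativeDimension (d + g) (Over.mk (A.X.hom ≫ S.hom) : SchemeOver k).hom := by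
  haveI : SmoothOfRelativeDimension g A.X.hom := hA
  change SmoothOfRelativeDimension (d + g) (A.X.hom ≫ S.hom)
  rw [Nat.add_comm]
  infer_instance

/-- The total space of an abelian scheme over a GEOMETRICALLY IRREDUCIBLE `k`-scheme is geometrically irreducible over `k`:
`A → S` is geometrically irreducible (★ `geometricallyIrreducible_hom_overBase`, [GortzWedhorn2020] Cor. 16.52) and universally
open (smooth ⇒ flat of finite presentation, Stacks 01UA), `S → Spec k` is universally open (a field), and geometrically
irreducible universally open morphisms compose (Stacks 038F, Mathlib `GeometricallyIrreducible.comp`).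
[cite: GortzWedhorn2020, Cor. 16.52 and Remark 16.54 (p. 539)] [cite: StacksProject, Tag 038F and Tag 01UA] -/
theorem geometricallyIrreducible_total [GeometricallyIrreducible S.hom] :
    GeometricallyIrreducible (Over.mk (A.X.hom ≫ S.hom) : SchemeOver k).hom := by
  haveI := A.isSmooth
  haveI : GeometricallyIrreducible A.X.hom := A.geometricallyIrreducible_hom_overBase
  change GeometricallyIrreducible (A.X.hom ≫ S.hom)
  exact GeometricallyIrreducible.comp _ _

/-- The total space of an abelian scheme over a PROPER `k`-scheme, if quasi-projective over `k`, is projective over `k` (§1).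
[cite: Hartshorne1977, II Cor. 4.8 (e) (p. 102) and §4 Definition (p. 103)] -/
theorem isProjectiveOver_total [IsProper S.hom]
    (hqp : IsQuasiProjectiveOver (Over.mk (A.X.hom ≫ S.hom) : SchemeOver k)) :
    IsProjectiveOver (Over.mk (A.X.hom ≫ S.hom) : SchemeOver k) := by
  haveI := A.isProper_total
  exact Literature.AlgebraicGeometry.HodgeTheory.isProjectiveOver_of_isProper_of_isQuasiProjectiveOver hqp

/-! ### §3 HEAD -/

/-- **(E6-Π) THE TOTAL SPACE OF AN ABELIAN SCHEME OVER A SMOOTH PROJECTIVE VARIETY IS A SMOOTH PROJECTIVE VARIETY.**  For `S` a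
smooth projective geometrically irreducible `k`-variety of dimension `d` (★ `IsSmoothProjective d S`), `A → S` an abelian scheme
of relative dimension `g` whose total space `A → S → Spec k` is quasi-projective over `k`: the total space is a smooth
projective geometrically irreducible `k`-variety of dimension `d + g` — the `IsSmoothProjective` binder of ★
`Transcendental.Arapura2012_Cor_15_4_6` (GAGA for maps) at the total space of the pulled-back universal family over a
projective curve piece (quasi-projectivity supplied there by ★ (F-c″) and ★ `isQuasiProjectiveOver_familyPullback_of_isSeparated`).
[cite: Hartshorne1977, II §4 (p. 103), Cor. 4.8 (p. 102), III Prop. 10.1 (p. 270)] [cite: GortzWedhorn2020, Cor. 16.52 (p. 539)]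
[cite: StacksProject, Tag 038F] -/
theorem isSmoothProjective_total {d g : ℕ} (hS : IsSmoothProjective d S) (hA : A.IsOfRelDim g)
    (hqp : IsQuasiProjectiveOver (Over.mk (A.X.hom ≫ S.hom) : SchemeOver k)) :
    IsSmoothProjective (d + g) (Over.mk (A.X.hom ≫ S.hom) : SchemeOver k) := by
  haveI := hS.smoothOfRelativeDimension
  haveI := hS.geometricallyIrreducible
  haveI : IsProper S.hom := hS.isProjectiveOver.isProper
  exact { smoothOfRelativeDimension := A.smoothOfRelativeDimension_total hA
          isProjectiveOver := A.isProjectiveOver_total hqp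
          geometricallyIrreducible := A.geometricallyIrreducible_total }

end Literature.AlgebraicGeometry.AbelianSchemes.AbelianSchemeOver

end
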